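import Literature.Probability.Percolation.FivePointNormalisation
import HarnessLib

/-!
# Five-point discrete holomorphicity, I: the core-triple faces at an interior face, their assembly, and the triple algebra

Topic `Literature/Probability/Percolation`; lane pcv-sawmu (CriticalPhenomena), door (v) «five-point observables on the
honeycomb», statement (H) of the lane's interface layer (`FiveMarkedLoops.lean`, Part 1): around every interior face `v` of a
five-marked discrete domain, `Σ_{k : Fin 3} τ^k F_j(v, ccwNbr v k) = 0` for the sparse observables
`F_j = H_{j,A} − τ² H_{j+1,B} − τ H_{j−1,B}` (`sparseObs`). This file (text: pcv-sawmu b-step0 g9, frozen faces ef88119d +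
assembly + HT4, carried verbatim up to the namespace, provenance tags and explicit domain binders on the face predicates) sets up
Khristoforov–Smirnov's TRIPLE BIJECTION AT A VERTEX (arXiv:2111.15612, Lemma 4) with five boundary disorders in the vocabulary of
`FivePointNormalisation.lean`: a CORE at the interior face `v` is an edge set avoiding the three sides of `v` whose odd faces are the
five corners and an odd number of the three neighbours `oppFace v k` (`IsCore`); its COMPLETION at `k` adds the sides towards the other
odd neighbours (`coreCompl`, odd endpoint `coreEnd`). Faces: HT1 `CoreDecomposition` (completions biject cores onto the six-odd-point
spaces at the three edges of `v`), HT2 `InvariantTriples` (one odd neighbour, or two linked to each other: the three completions have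
the same class), HT3 `ReLinkingTriples` (three odd neighbours linked to three corners: the planar re-linking shape), HT4 `TripleAlgebra`
(the `ℚ(τ)` identity, PROVED here: `tripleAlgebra_holds`); ASSEMBLY `hexFivePointHolomorphy_of_faces` (HT1–HT4 ⇒ (H) at `D`, real
proof: `sparseObs` as class counts by `sixTransport_holds`, regrouping over cores, `1 + τ + τ² = 0`). HT1/HT2 are proved in
`FivePointCoreTriples.lean`, HT3 and (H) for every domain in `FivePointHolomorphy.lean`.

## References
* M. Khristoforov, S. Smirnov, *Percolation and O(1) loop model*, arXiv:2111.15612 (2021), §1.2 and Lemma 4 (discrete holomorphicity).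
* B. Bollobás, O. Riordan, *Percolation*, Cambridge University Press (2006), Ch. 7 §7.2.2 pp. 168–171 (Lemma 5, Fig. 9).
-/

open Finset

/-! # ═══════════════════════ (H) ∀ D — THE CORE-TRIPLE FACES (pcv-sawmu b-step0 gen 9; frozen text ef88119d) ═══════════════════════

The «core-triple» form of Khristoforov–Smirnov's Lemma 4 (triple bijection at a vertex) with five boundary disorders, in the §N5/§N3
vocabulary. Fix an interior face `v` (all three vertices in `G`); its three neighbours are `oppFace v k` across the bonds `side v k`,
`k : Fin 3` — this indexing is ANTICLOCKWISE around `v` for both face orientations (for an up face `ccwNbr v k = oppFace v (k+2)`, for a down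
face `ccwNbr v k = oppFace v k`), so the (H) sum may be taken over `oppFace v k` with weights `τ^k`. A CORE is an edge set avoiding the three
sides of `v` whose odd touching faces are the five corners and an odd number of the three neighbours; its COMPLETION at `k` adds the sides
towards the OTHER odd neighbours. Data: `HOME/code/step0/g9/n123/hcore_check.py` — hexBall1Five 768/768 triples and R44 (two deepest faces)
131 072/131 072 triples pass HT1–HT4 below. No proofs here: `def … : Prop` faces + the intended assembly as a `Prop`. -/

namespace Literature.Probability.Percolation.FivePoint

open Finset Literature.Probability.Percolation Literature.Probability.LatticeModels Literature.Probability.Percolation.FivePoint TriMarkedDomain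

variable (D : TriMarkedDomain 5)

namespace N5

open Classical in
/-- edge sets of `H_G` avoiding the three sides of the face `v`. [cite: KhristoforovSmirnov2021, Lemma 4 (discrete holomorphicity: the triple bijection at a vertex)] -/
noncomputable def Eminus (v : HexVertex) : Finset (Sym2 (Site 2)) :=
  (hBonds D).filter fun b => ∀ j : Fin 3, b ≠ side v j

/-- a CORE at the interior face `v` with odd-neighbour index set `S` (`|S|` odd; `v` itself is isolated, hence even):
an edge set avoiding the sides of `v` whose odd touching faces are the five corners and the neighbours `oppFace v i`, `i ∈ S`. [cite: KhristoforovSmirnov2021, Lemma 4 (discrete holomorphicity: the triple bijection at a vertex)] -/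
def IsCore (v : HexVertex) (S : Finset (Fin 3)) (ζ : Finset (Sym2 (Site 2))) : Prop :=
  ζ ⊆ Eminus D v ∧ Odd S.card ∧ ParityIs D ζ (corners D ∪ S.image (oppFace v))

/-- the COMPLETION of a core at position `k`: add the sides of `v` towards the odd neighbours other than `k`. [cite: KhristoforovSmirnov2021, Lemma 4 (discrete holomorphicity: the triple bijection at a vertex)] -/
def coreCompl (v : HexVertex) (S : Finset (Fin 3)) (k : Fin 3) (ζ : Finset (Sym2 (Site 2))) : Finset (Sym2 (Site 2)) :=
  ζ ∪ (S.erase k).image (side v)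

/-- the odd endpoint of the completion at `k`: the neighbour `oppFace v k` if it is odd in the core, else `v`. [cite: KhristoforovSmirnov2021, Lemma 4 (discrete holomorphicity: the triple bijection at a vertex)] -/
def coreEnd (v : HexVertex) (S : Finset (Fin 3)) (k : Fin 3) : HexVertex := if k ∈ S then oppFace v k else v

/-- the six-odd-point space AT the `k`-th edge of `v` with endpoint `s` (N1–N3's `loopSpace6` for the bond `side v k`). [cite: KhristoforovSmirnov2021, Lemma 4 (discrete holomorphicity: the triple bijection at a vertex)] -/
noncomputable def T6at (v : HexVertex) (k : Fin 3) (s : HexVertex) : Finset (Finset (Sym2 (Site 2))) :=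
  loopSpace6 D (faceVertex v (k + 1)) (faceVertex v (k + 2)) s

/-- the class predicate of the completion at `k` (N2's `InClass` at the `k`-th edge; `∃!` by `sixStructure_holds`). [cite: KhristoforovSmirnov2021, Lemma 4 (discrete holomorphicity: the triple bijection at a vertex)] -/
def ComplClass (v : HexVertex) (S : Finset (Fin 3)) (k : Fin 3) (ζ : Finset (Sym2 (Site 2))) (r : Fin 5) (m : Bool) : Prop :=
  InClass D (faceVertex v (k + 1)) (faceVertex v (k + 2)) (coreEnd v S k) r m (coreCompl v S k ζ)

/-- **HT1 (CORE DECOMPOSITION)**: for each `k`, `(S, ζ) ↦ coreCompl v S k ζ` is a bijection from the cores at `v` onto the six-odd-point space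
at the `k`-th edge (both endpoints), landing in the summand with endpoint `coreEnd v S k`; inverse = delete the sides of `v`. Pure parity
bookkeeping (XorDeg / parity_shift). [cite: KhristoforovSmirnov2021, Lemma 4 (discrete holomorphicity: the triple bijection at a vertex)] -/
def CoreDecomposition (D : TriMarkedDomain 5) : Prop :=
  ∀ v : HexVertex, hexFaceVertices v ⊆ D.verts → ∀ k : Fin 3,
    (∀ (S : Finset (Fin 3)) (ζ : Finset (Sym2 (Site 2))), IsCore D v S ζ → coreCompl v S k ζ ∈ T6at D v k (coreEnd v S k)) ∧
    (∀ s ∈ ({v, oppFace v k} : Finset HexVertex), ∀ ξ ∈ T6at D v k s,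
      ∃! p : Finset (Fin 3) × Finset (Sym2 (Site 2)), IsCore D v p.1 p.2 ∧ coreEnd v p.1 k = s ∧ coreCompl v p.1 k p.2 = ξ)

/-- **HT2 (INVARIANT TRIPLES)**: if the core has ONE odd neighbour (type I: the completions hang `v` off that neighbour's path), or three odd
neighbours two of which are linked to each other in the core (type IIb: the completions close a loop through `v`), then the three completions
have the same class. Max-degree-two combinatorics (N2's `component_facts`/`odd_component`). [cite: KhristoforovSmirnov2021, Lemma 4 (discrete holomorphicity: the triple bijection at a vertex)] -/
def InvariantTriples (D : TriMarkedDomain 5) : Prop :=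
  ∀ v : HexVertex, hexFaceVertices v ⊆ D.verts → ∀ (S : Finset (Fin 3)) (ζ : Finset (Sym2 (Site 2))), IsCore D v S ζ →
    (S.card = 1 ∨ ∃ i ∈ S, ∃ i' ∈ S, i ≠ i' ∧ XiLinked ζ (oppFace v i) (oppFace v i')) →
      ∀ (k k' : Fin 3) (r : Fin 5) (m : Bool), ComplClass D v S k ζ r m ↔ ComplClass D v S k' ζ r m

/-- **HT3 (RE-LINKING TRIPLES — the planar face)**: if all three neighbours are odd and each is core-linked to a corner, `oppFace v k ~ y_{p k}`,
then the two remaining corners form an ADJACENT pair `{y_c, y_{c+1}}` linked to each other, the corners `(p 0, p 1, p 2)` are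
`(c+2, c+3, c+4)` UP TO A CYCLIC ROTATION of `Fin 3` (= anticlockwise on `∂`, like the neighbours around `v`), and the completion at `k` has class
`(p k, A)` for `p k ∈ {c+2, c+4}` and `(p k, B)` for `p k = c+3`. The only genuinely planar piece (three disjoint paths from the neighbours
of an interior face to the boundary respect the cyclic order; the fourth path does not separate them). [cite: KhristoforovSmirnov2021, Lemma 4 (discrete holomorphicity: the triple bijection at a vertex)] -/
def ReLinkingTriples (D : TriMarkedDomain 5) : Prop :=
  ∀ v : HexVertex, hexFaceVertices v ⊆ D.verts → ∀ ζ : Finset (Sym2 (Site 2)), IsCore D v Finset.univ ζ →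
    ∀ p : Fin 3 → Fin 5, (∀ k : Fin 3, XiLinked ζ (oppFace v k) (yc D (p k))) →
      ∃ c : Fin 5, ∃ rot : Fin 3,
        XiLinked ζ (yc D c) (yc D (c + 1)) ∧ p rot = c + 2 ∧ p (rot + 1) = c + 3 ∧ p (rot + 2) = c + 4 ∧
          ∀ k : Fin 3, ComplClass D v Finset.univ k ζ (p k) (decide (p k = c + 3))

/-- the weight of the class `(r, M)` in the sparse observable `F_j` (D6-PILOT §9): `+1` on `(j, A)`, `−τ²` on `(j+1, B)`, `−τ` on `(j−1, B)`. [cite: KhristoforovSmirnov2021, Lemma 4 (discrete holomorphicity: the triple bijection at a vertex)] -/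
noncomputable def phiW (j : Fin 5) (r : Fin 5) (m : Bool) : ℂ :=
  (if r = j ∧ m = false then 1 else 0) - (if r = j + 1 ∧ m = true then tau ^ 2 else 0) - (if r = j + 4 ∧ m = true then tau else 0)

/-- **HT4 (TRIPLE ALGEBRA)**: a re-linking triple of the shape given by HT3 contributes zero to `Σ_k τ^k F_j(e_k)` for every `j`
(a finite identity in `ℚ(τ)`, `τ² + τ + 1 = 0`; invariant triples contribute `(1 + τ + τ²)·φ = 0` trivially). [cite: KhristoforovSmirnov2021, Lemma 4 (discrete holomorphicity: the triple bijection at a vertex)] -/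
def TripleAlgebra : Prop :=
  ∀ (c j : Fin 5) (rot : Fin 3) (p : Fin 3 → Fin 5), p rot = c + 2 → p (rot + 1) = c + 3 → p (rot + 2) = c + 4 →
    ∑ k : Fin 3, tau ^ (k : ℕ) * phiW j (p k) (decide (p k = c + 3)) = 0

/-- (H) at the interior face `v`, in the `oppFace` indexing (equivalent to D1-v2's `ccwNbr` form up to the factor `τ²` for up faces). [cite: KhristoforovSmirnov2021, Lemma 4 (discrete holomorphicity: the triple bijection at a vertex)] -/
def HolomorphyAt (v : HexVertex) : Prop :=
  ∀ (c : Bool) (j : Fin 5), ∑ k : Fin 3, tau ^ (k : ℕ) * sparseObs D j c v (oppFace v k) = 0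

/-- **THE INTENDED ASSEMBLY** (day-3 item «H-ASSEMBLY», real proof to be written: `sparseObs` → `patternProb` → class counts over
`T6at` by N3's `sixTransport_holds`; regroup `Σ_k τ^k Σ_{ξ ∈ T(k)} φ_j(class ξ)` over cores by HT1; HT2-triples vanish by `1+τ+τ² = 0`,
HT3-triples by HT4). Stated as a `Prop` so that custody can freeze the exact shape. [cite: KhristoforovSmirnov2021, Lemma 4 (discrete holomorphicity: the triple bijection at a vertex)] -/
def HolomorphyAssembly (D : TriMarkedDomain 5) : Prop :=
  CoreDecomposition D → InvariantTriples D → ReLinkingTriples D → TripleAlgebra →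
    ∀ v : HexVertex, hexFaceVertices v ⊆ D.verts → HolomorphyAt D v

/-- sanity: the draft faces imply D1-v2's (H) for `D` once the assembly and the `ccwNbr`/`oppFace` reindexing are proved (recorded shape). [cite: KhristoforovSmirnov2021, Lemma 4 (discrete holomorphicity: the triple bijection at a vertex)] -/
def HolomorphyTarget (D : TriMarkedDomain 5) : Prop := ∀ v : HexVertex, hexFaceVertices v ⊆ D.verts → HolomorphyAt D v

end N5

end Literature.Probability.Percolation.FivePoint

/-! # ═══════════════════════ (H) ∀ D — ASSEMBLY (b-step0 gen 9): faces HT1–HT4 ⇒ holomorphicity at every interior face ═══════════════════════ -/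

namespace Literature.Probability.Percolation.FivePoint

open Finset Literature.Probability.Percolation Literature.Probability.LatticeModels Literature.Probability.Percolation.FivePoint TriMarkedDomain

variable (D : TriMarkedDomain 5)

namespace N5

/-! #### HA1. `patternProb` as a count, and the class counts at the `k`-th edge of an interior face -/

open Classical in
/-- `patternProb` as a count over the open sets `T ⊆ G` (locality of `MatchA/MatchB/Joined`). [cite: KhristoforovSmirnov2021, Lemma 4 (discrete holomorphicity: the triple bijection at a vertex)] -/
theorem ha_patternProb_eq_card_div (r : Fin 5) (c m : Bool) (x x' : HexVertex) :
    patternProb D r c m x x' =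
      (#(D.verts.powerset.filter fun T : Finset (Site 2) =>
          (if m then MatchB D (↑T : Set (Site 2)) r c else MatchA D (↑T : Set (Site 2)) r c) ∧
            (Joined D (↑T : Set (Site 2)) r c x ∨ Joined D (↑T : Set (Site 2)) r c x')) : ℝ) / 2 ^ #D.verts := by
  unfold patternProb
  convert triSitePercolation_half_real_setOf_eq_card_div
    (P := fun σ => (if m then MatchB D σ r c else MatchA D σ r c) ∧ (Joined D σ r c x ∨ Joined D σ r c x')) D.verts
    (fun σ => by
      have hl := loopLocal_holds D σ r c
      rw [joined_inter_iff, joined_inter_iff]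
      cases m
      · simp only [Bool.false_eq_true, ↓reduceIte]; rw [← hl.1]
      · simp only [↓reduceIte]; rw [← hl.2]) using 4
  exact (Finset.filter_congr_decidable _ _ _).symm

open Classical in
/-- the class count `W_{r,M}` at the `k`-th edge of the face `v` (both odd endpoints). [cite: KhristoforovSmirnov2021, Lemma 4 (discrete holomorphicity: the triple bijection at a vertex)] -/
noncomputable def Wc (v : HexVertex) (k : Fin 3) (r : Fin 5) (m : Bool) : ℕ :=
  #((T6at D v k v).filter fun ξ => InClass D (faceVertex v (k + 1)) (faceVertex v (k + 2)) v r m ξ) +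
    #((T6at D v k (oppFace v k)).filter fun ξ => InClass D (faceVertex v (k + 1)) (faceVertex v (k + 2)) (oppFace v k) r m ξ)

open Classical in
/-- N3 at the `k`-th edge of an interior face: the colouring count of the pattern event is the class count. [cite: KhristoforovSmirnov2021, Lemma 4 (discrete holomorphicity: the triple bijection at a vertex)] -/
theorem ha_card_event_eq_Wc {v : HexVertex} (hv : hexFaceVertices v ⊆ D.verts) (k : Fin 3) (c : Bool) (r : Fin 5) (m : Bool) :
    #(D.verts.powerset.filter fun T : Finset (Site 2) =>
        (if m then MatchB D (↑T : Set (Site 2)) r c else MatchA D (↑T : Set (Site 2)) r c) ∧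
          (Joined D (↑T : Set (Site 2)) r c v ∨ Joined D (↑T : Set (Site 2)) r c (oppFace v k))) = Wc D v k r m := by
  unfold Wc T6at
  exact (sixTransport_holds D v (oppFace v k) (faceVertex v (k + 1)) (faceVertex v (k + 2)) hv (hexGraph_adj_oppFace v k)
    (faceEdge_oppFace v k) (hv (faceVertex_mem v _)) (hv (faceVertex_mem v _)) c r m).symm

/-- `2^{#G} · F_j(e_k)` in terms of the class counts. [cite: KhristoforovSmirnov2021, Lemma 4 (discrete holomorphicity: the triple bijection at a vertex)] -/
theorem ha_sparseObs_eq {v : HexVertex} (hv : hexFaceVertices v ⊆ D.verts) (k : Fin 3) (c : Bool) (j : Fin 5) :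
    (2 : ℂ) ^ #D.verts * sparseObs D j c v (oppFace v k) =
      (Wc D v k j false : ℂ) - tau ^ 2 * (Wc D v k (j + 1) true : ℂ) - tau * (Wc D v k (j + 4) true : ℂ) := by
  classical
  unfold sparseObs
  rw [ha_patternProb_eq_card_div, ha_patternProb_eq_card_div, ha_patternProb_eq_card_div,
    ha_card_event_eq_Wc D hv, ha_card_event_eq_Wc D hv, ha_card_event_eq_Wc D hv]
  have h2 : (2 : ℂ) ^ #D.verts ≠ 0 := pow_ne_zero _ two_ne_zero
  push_cast
  field_simp

/-- `τ = e^{2πi/3} = -1/2 + (√3/2) i`. [folklore] -/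
private theorem ha_tau_eq : tau = (-1 / 2 : ℂ) + (Real.sqrt 3 / 2 : ℝ) * Complex.I := by
  unfold tau
  have harg : (2 * Real.pi * Complex.I / 3 : ℂ) = ((2 * Real.pi / 3 : ℝ) : ℂ) * Complex.I := by push_cast; ring
  rw [harg, Complex.exp_mul_I, ← Complex.ofReal_cos, ← Complex.ofReal_sin]
  have hc : Real.cos (2 * Real.pi / 3) = -1 / 2 := by
    rw [show 2 * Real.pi / 3 = Real.pi - Real.pi / 3 by ring, Real.cos_pi_sub, Real.cos_pi_div_three]; norm_num
  have hs : Real.sin (2 * Real.pi / 3) = Real.sqrt 3 / 2 := by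
    rw [show 2 * Real.pi / 3 = Real.pi - Real.pi / 3 by ring, Real.sin_pi_sub, Real.sin_pi_div_three]
  rw [hc, hs]
  push_cast
  ring

/-- `1 + τ + τ² = 0`. [folklore] -/
private theorem ha_tau_sum : 1 + tau + tau ^ 2 = 0 := by
  rw [ha_tau_eq]
  have hb : ((Real.sqrt 3 : ℝ) : ℂ) ^ 2 = 3 := by
    have := Real.sq_sqrt (show (0 : ℝ) ≤ 3 by norm_num)
    exact_mod_cast this
  push_cast
  linear_combination (((Real.sqrt 3 : ℝ) : ℂ) ^ 2 / 4) * Complex.I_sq + (-1 / 4 : ℂ) * hb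

/-! #### HA2. Weighted class counts as sums of per-configuration weights -/

open Classical in
/-- the `F_j`-weight of a configuration with class predicate `I` (exactly one class holds, by N2). [cite: KhristoforovSmirnov2021, Lemma 4 (discrete holomorphicity: the triple bijection at a vertex)] -/
noncomputable def gphi (j : Fin 5) (I : Fin 5 → Bool → Prop) : ℂ :=
  (if I j false then 1 else 0) - tau ^ 2 * (if I (j + 1) true then 1 else 0) - tau * (if I (j + 4) true then 1 else 0)

open Classical in
/-- three weighted class counts = the sum of the weights. [cite: KhristoforovSmirnov2021, Lemma 4 (discrete holomorphicity: the triple bijection at a vertex)] -/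
theorem ha_weighted_counts_eq_sum (T : Finset (Finset (Sym2 (Site 2)))) (I : Finset (Sym2 (Site 2)) → Fin 5 → Bool → Prop)
    (j : Fin 5) :
    (#(T.filter fun ξ => I ξ j false) : ℂ) - tau ^ 2 * (#(T.filter fun ξ => I ξ (j + 1) true) : ℂ)
        - tau * (#(T.filter fun ξ => I ξ (j + 4) true) : ℂ) = ∑ ξ ∈ T, gphi j (I ξ) := by
  simp only [gphi, Finset.natCast_card_filter, Finset.sum_sub_distrib, Finset.mul_sum]

/-- the per-configuration weight at the `k`-th edge of `v` with odd endpoint `s`. [cite: KhristoforovSmirnov2021, Lemma 4 (discrete holomorphicity: the triple bijection at a vertex)] -/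
noncomputable def Gk (v : HexVertex) (k : Fin 3) (j : Fin 5) (s : HexVertex) (ξ : Finset (Sym2 (Site 2))) : ℂ :=
  gphi j fun r m => InClass D (faceVertex v (k + 1)) (faceVertex v (k + 2)) s r m ξ

open Classical in
/-- `2^{#G} · F_j(e_k)` as a sum of weights over the six-odd-point space at the `k`-th edge (both odd endpoints). [cite: KhristoforovSmirnov2021, Lemma 4 (discrete holomorphicity: the triple bijection at a vertex)] -/
theorem ha_sparseObs_eq_sum {v : HexVertex} (hv : hexFaceVertices v ⊆ D.verts) (k : Fin 3) (c : Bool) (j : Fin 5) :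
    (2 : ℂ) ^ #D.verts * sparseObs D j c v (oppFace v k) =
      ∑ ξ ∈ T6at D v k v, Gk D v k j v ξ + ∑ ξ ∈ T6at D v k (oppFace v k), Gk D v k j (oppFace v k) ξ := by
  rw [ha_sparseObs_eq D hv]
  unfold Wc Gk
  rw [← ha_weighted_counts_eq_sum, ← ha_weighted_counts_eq_sum]
  push_cast
  ring

/-! #### HA3. Regrouping over cores (HT1) -/

open Classical in
/-- the cores at `v`, as a finset of pairs `(S, ζ)`. [cite: KhristoforovSmirnov2021, Lemma 4 (discrete holomorphicity: the triple bijection at a vertex)] -/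
noncomputable def coreSet (v : HexVertex) : Finset (Finset (Fin 3) × Finset (Sym2 (Site 2))) :=
  ((Finset.univ : Finset (Finset (Fin 3))) ×ˢ (Eminus D v).powerset).filter fun q => IsCore D v q.1 q.2

open Classical in
/-- (H) bookkeeping. [cite: KhristoforovSmirnov2021, Lemma 4 (discrete holomorphicity: the triple bijection at a vertex)] -/
theorem ha_mem_coreSet {v : HexVertex} {q : Finset (Fin 3) × Finset (Sym2 (Site 2))} :
    q ∈ coreSet D v ↔ IsCore D v q.1 q.2 := by
  unfold coreSet
  rw [Finset.mem_filter, Finset.mem_product, Finset.mem_powerset]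
  constructor
  · exact fun h => h.2
  · intro h; exact ⟨⟨Finset.mem_univ _, h.1⟩, h⟩

/-- the odd endpoint of a completion is `v` or the `k`-th neighbour. [cite: KhristoforovSmirnov2021, Lemma 4 (discrete holomorphicity: the triple bijection at a vertex)] -/
theorem ha_coreEnd_eq_or (v : HexVertex) (S : Finset (Fin 3)) (k : Fin 3) : coreEnd v S k = v ∨ coreEnd v S k = oppFace v k := by
  unfold coreEnd; split_ifs
  · exact Or.inr rfl
  · exact Or.inl rfl

open Classical in
/-- **regrouping**: the sum of weights over the six-odd-point space at the `k`-th edge equals the sum over cores of the weight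
of the `k`-th completion (HT1). [cite: KhristoforovSmirnov2021, Lemma 4 (discrete holomorphicity: the triple bijection at a vertex)] -/
theorem ha_regroup (h1 : CoreDecomposition D) {v : HexVertex} (hv : hexFaceVertices v ⊆ D.verts) (k : Fin 3)
    (G : HexVertex → Finset (Sym2 (Site 2)) → ℂ) :
    ∑ ξ ∈ T6at D v k v, G v ξ + ∑ ξ ∈ T6at D v k (oppFace v k), G (oppFace v k) ξ =
      ∑ q ∈ coreSet D v, G (coreEnd v q.1 k) (coreCompl v q.1 k q.2) := by
  obtain ⟨hmap, huniq⟩ := h1 v hv k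
  have hne : v ≠ oppFace v k := (hexGraph_adj_oppFace v k).ne
  -- split the cores by the odd endpoint of their `k`-th completion
  rw [← Finset.sum_filter_add_sum_filter_not (coreSet D v) (fun q => coreEnd v q.1 k = v)]
  congr 1
  · -- endpoint `v`
    symm
    refine Finset.sum_nbij (fun q => coreCompl v q.1 k q.2) (fun q hq => ?_) (fun q₁ hq₁ q₂ hq₂ heq => ?_) (fun ξ hξ => ?_)
      (fun q hq => ?_)
    · rw [Finset.mem_filter, ha_mem_coreSet] at hq
      have := hmap q.1 q.2 hq.1
      rw [hq.2] at this; exact this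
    · rw [Finset.mem_coe, Finset.mem_filter, ha_mem_coreSet] at hq₁ hq₂
      have hξ := hmap q₁.1 q₁.2 hq₁.1
      rw [hq₁.2] at hξ
      obtain ⟨p, -, hpu⟩ := huniq v (by simp) _ hξ
      have e1 := hpu q₁ ⟨hq₁.1, hq₁.2, rfl⟩
      have e2 := hpu q₂ ⟨hq₂.1, hq₂.2, heq.symm⟩
      exact e1.trans e2.symm
    · rw [Finset.mem_coe] at hξ
      obtain ⟨p, ⟨hc, hend, hcomp⟩, -⟩ := huniq v (by simp) _ hξ
      exact ⟨p, by rw [Finset.mem_coe, Finset.mem_filter, ha_mem_coreSet]; exact ⟨hc, hend⟩, hcomp⟩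
    · rw [Finset.mem_filter] at hq
      rw [hq.2]
  · -- endpoint `oppFace v k`
    symm
    refine Finset.sum_nbij (fun q => coreCompl v q.1 k q.2) (fun q hq => ?_) (fun q₁ hq₁ q₂ hq₂ heq => ?_) (fun ξ hξ => ?_)
      (fun q hq => ?_)
    · rw [Finset.mem_filter, ha_mem_coreSet] at hq
      have hend : coreEnd v q.1 k = oppFace v k := (ha_coreEnd_eq_or v q.1 k).resolve_left hq.2
      have := hmap q.1 q.2 hq.1
      rw [hend] at this; exact this
    · rw [Finset.mem_coe, Finset.mem_filter, ha_mem_coreSet] at hq₁ hq₂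
      have hend₁ : coreEnd v q₁.1 k = oppFace v k := (ha_coreEnd_eq_or v q₁.1 k).resolve_left hq₁.2
      have hend₂ : coreEnd v q₂.1 k = oppFace v k := (ha_coreEnd_eq_or v q₂.1 k).resolve_left hq₂.2
      have hξ := hmap q₁.1 q₁.2 hq₁.1
      rw [hend₁] at hξ
      obtain ⟨p, -, hpu⟩ := huniq (oppFace v k) (by simp) _ hξ
      have e1 := hpu q₁ ⟨hq₁.1, hend₁, rfl⟩
      have e2 := hpu q₂ ⟨hq₂.1, hend₂, heq.symm⟩
      exact e1.trans e2.symm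
    · rw [Finset.mem_coe] at hξ
      obtain ⟨p, ⟨hc, hend, hcomp⟩, -⟩ := huniq (oppFace v k) (by simp) _ hξ
      refine ⟨p, ?_, hcomp⟩
      rw [Finset.mem_coe, Finset.mem_filter, ha_mem_coreSet]
      exact ⟨hc, by rw [hend]; exact hne.symm⟩
    · rw [Finset.mem_filter] at hq
      rw [(ha_coreEnd_eq_or v q.1 k).resolve_left hq.2]


end N5

end Literature.Probability.Percolation.FivePoint

/-! #### HA4. Every core triple contributes zero -/

namespace Literature.Probability.Percolation.FivePoint

open Finset Literature.Probability.Percolation Literature.Probability.LatticeModels Literature.Probability.Percolation.FivePoint TriMarkedDomain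

variable (D : TriMarkedDomain 5)

namespace N5

/-- the weight of a configuration whose only class is `(a, b)` is `φ_j(a, b)`. [cite: KhristoforovSmirnov2021, Lemma 4 (discrete holomorphicity: the triple bijection at a vertex)] -/
theorem ha_gphi_eq_phiW (j a : Fin 5) (b : Bool) : gphi j (fun r m => r = a ∧ m = b) = phiW j a b := by
  classical
  unfold gphi phiW
  cases b <;> by_cases h0 : a = j <;> by_cases h1 : a = j + 1 <;> by_cases h4 : a = j + 4 <;>
    simp [h0, h1, h4, @eq_comm _ j a, @eq_comm _ (j + 1) a, @eq_comm _ (j + 4) a]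

open Classical in
/-- uniqueness of the class of the `k`-th completion (N2 at the `k`-th edge) turns its weight into `φ_j` of that class. [cite: KhristoforovSmirnov2021, Lemma 4 (discrete holomorphicity: the triple bijection at a vertex)] -/
theorem ha_Gk_eq_phiW (h1 : CoreDecomposition D) {v : HexVertex} (hv : hexFaceVertices v ⊆ D.verts) (k : Fin 3) (j : Fin 5)
    {S : Finset (Fin 3)} {ζ : Finset (Sym2 (Site 2))} (hq : IsCore D v S ζ) {a : Fin 5} {b : Bool}
    (hcls : ComplClass D v S k ζ a b) :
    Gk D v k j (coreEnd v S k) (coreCompl v S k ζ) = phiW j a b := by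
  have hξ : coreCompl v S k ζ ∈ T6at D v k (coreEnd v S k) := (h1 v hv k).1 S ζ hq
  have hs : coreEnd v S k ∈ ({v, oppFace v k} : Finset HexVertex) := by
    rcases ha_coreEnd_eq_or v S k with h | h <;> rw [h] <;> simp
  have huniq := sixStructure_holds D v (oppFace v k) (faceVertex v (k + 1)) (faceVertex v (k + 2)) hv (hexGraph_adj_oppFace v k)
    (faceEdge_oppFace v k) (hv (faceVertex_mem v _)) (hv (faceVertex_mem v _)) (coreEnd v S k) hs (coreCompl v S k ζ) hξ
  have key : (fun r m => InClass D (faceVertex v (k + 1)) (faceVertex v (k + 2)) (coreEnd v S k) r m (coreCompl v S k ζ)) =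
      fun r m => r = a ∧ m = b := by
    funext r m
    apply propext
    constructor
    · intro h
      have e := huniq.unique (y₁ := (r, m)) (y₂ := (a, b)) h hcls
      exact ⟨congrArg Prod.fst e, congrArg Prod.snd e⟩
    · rintro ⟨rfl, rfl⟩; exact hcls
  unfold Gk
  rw [key, ha_gphi_eq_phiW]

/-- the cores avoid the sides of `v`: `Eminus ⊆ hBonds` and no `side v j` lies in a core. [cite: KhristoforovSmirnov2021, Lemma 4 (discrete holomorphicity: the triple bijection at a vertex)] -/
theorem ha_core_sub {v : HexVertex} {S : Finset (Fin 3)} {ζ : Finset (Sym2 (Site 2))} (hq : IsCore D v S ζ) :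
    ζ ⊆ hBonds D ∧ ∀ j : Fin 3, side v j ∉ ζ := by
  classical
  have hsub := hq.1
  unfold Eminus at hsub
  refine ⟨fun b hb => (Finset.mem_filter.1 (hsub hb)).1, fun j hj => ?_⟩
  exact (Finset.mem_filter.1 (hsub hj)).2 j rfl

/-- at most two sides if one side is missing. [folklore] -/
private theorem card_filter_le_two_of_not {p : Fin 3 → Prop} [DecidablePred p] {j₀ : Fin 3} (h : ¬ p j₀) :
    #((Finset.univ : Finset (Fin 3)).filter p) ≤ 2 := by
  have hsub : (Finset.univ : Finset (Fin 3)).filter p ⊆ Finset.univ.erase j₀ := by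
    intro j hj
    rw [Finset.mem_erase]
    exact ⟨fun e => h (e ▸ (Finset.mem_filter.1 hj).2), Finset.mem_univ _⟩
  exact (Finset.card_le_card hsub).trans (by rw [Finset.card_erase_of_mem (Finset.mem_univ _)]; simp)

open Classical in
/-- **degrees in a core are at most two** (corners have a side off `H_G`; an odd neighbour `oppFace v i` has its side towards `v` off the
core; the other faces are even). [cite: KhristoforovSmirnov2021, Lemma 4 (discrete holomorphicity: the triple bijection at a vertex)] -/
theorem ha_core_deg_le_two {v : HexVertex} {S : Finset (Fin 3)} {ζ : Finset (Sym2 (Site 2))} (hq : IsCore D v S ζ) (F : HexVertex) :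
    xiDeg ζ F ≤ 2 := by
  obtain ⟨hζh, hside⟩ := ha_core_sub D hq
  have hpar := hq.2.2
  by_cases hF : F ∈ triFacesTouching D.verts
  · by_cases hodd : Odd (xiDeg ζ F)
    · have hmem := (hpar F hF).1 hodd
      rcases Finset.mem_union.1 hmem with hc | hx
      · obtain ⟨i, hi⟩ := (mem_corners D).1 hc
        obtain ⟨j₀, hj₀⟩ := exists_side_not_mem_hBonds_of_corner D ((isCornerFace_iff_eq_yc D).2 hi)
        exact card_filter_le_two_of_not (j₀ := j₀) fun h => hj₀ (hζh h)
      · obtain ⟨i, -, rfl⟩ := Finset.mem_image.1 hx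
        refine card_filter_le_two_of_not (j₀ := oppIdx v i) fun h => ?_
        have h' : side (oppFace v i) (oppIdx v i) ∈ ζ := h
        rw [side_oppFace_oppIdx] at h'
        exact hside i h'
    · have h3 : xiDeg ζ F ≤ 3 := (Finset.card_filter_le _ _).trans (by simp)
      rcases Nat.even_or_odd (xiDeg ζ F) with ⟨k, hk⟩ | ho
      · omega
      · exact absurd ho hodd
  · have : xiDeg ζ F = 0 := by
      unfold xiDeg
      rw [Finset.card_eq_zero, Finset.filter_eq_empty_iff]
      intro j _ hj
      exact hF (mem_touching_of_side_mem D (hζh hj))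
    omega

open Classical in
/-- **corner partners**: in a core with all three neighbours odd and no two of them linked, each neighbour is linked to a corner. [cite: KhristoforovSmirnov2021, Lemma 4 (discrete holomorphicity: the triple bijection at a vertex)] -/
theorem ha_core_partners {v : HexVertex} (hv : hexFaceVertices v ⊆ D.verts) {ζ : Finset (Sym2 (Site 2))} (hq : IsCore D v Finset.univ ζ)
    (hnl : ∀ i i' : Fin 3, i ≠ i' → ¬ XiLinked ζ (oppFace v i) (oppFace v i')) (k : Fin 3) :
    ∃ i : Fin 5, XiLinked ζ (oppFace v k) (yc D i) := by
  obtain ⟨hζh, -⟩ := ha_core_sub D hq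
  have hpar := hq.2.2
  have hmem : faceVertex v (k + 1) ∈ hexFaceVertices (oppFace v k) := by
    have h' : faceVertex v (k + 1) ∈ faceEdge v (oppFace v k) := by rw [faceEdge_oppFace]; simp
    exact (Finset.mem_inter.1 (show faceVertex v (k + 1) ∈ hexFaceVertices v ∩ hexFaceVertices (oppFace v k) from h')).2
  have hxt : oppFace v k ∈ triFacesTouching D.verts :=
    mem_triFacesTouching.2 ⟨faceVertex v (k + 1), hv (faceVertex_mem v _), hmem⟩
  have hxodd : Odd (xiDeg ζ (oppFace v k)) :=
    (hpar _ hxt).2 (Finset.mem_union_right _ (Finset.mem_image.2 ⟨k, Finset.mem_univ _, rfl⟩))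
  obtain ⟨⟨Y, hYne, hYodd, hreach⟩, -⟩ := odd_component D hζh (ha_core_deg_le_two D hq) hxt hxodd
  have hYt : Y ∈ triFacesTouching D.verts := by
    obtain ⟨w⟩ := hreach.symm
    cases w with
    | nil => exact absurd rfl hYne
    | cons hadj _ => exact sideGraph_adj_touching D hζh hadj
  have hYmem := (hpar Y hYt).1 hYodd
  rcases Finset.mem_union.1 hYmem with hc | hx
  · obtain ⟨i, rfl⟩ := (mem_corners D).1 hc
    exact ⟨i, (xiLinked_iff_reachable _ _ _).2 hreach⟩
  · obtain ⟨i, -, rfl⟩ := Finset.mem_image.1 hx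
    have hik : k ≠ i := fun e => hYne (by rw [e])
    exact absurd ((xiLinked_iff_reachable _ _ _).2 hreach) (hnl k i hik)

open Classical in
/-- **every core triple contributes zero** to `Σ_k τ^k · 2^{#G} F_j(e_k)`. [cite: KhristoforovSmirnov2021, Lemma 4 (discrete holomorphicity: the triple bijection at a vertex)] -/
theorem ha_core_vanish (h1 : CoreDecomposition D) (h2 : InvariantTriples D) (h3 : ReLinkingTriples D) (h4 : TripleAlgebra)
    {v : HexVertex} (hv : hexFaceVertices v ⊆ D.verts) (j : Fin 5) {S : Finset (Fin 3)} {ζ : Finset (Sym2 (Site 2))}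
    (hq : IsCore D v S ζ) :
    ∑ k : Fin 3, tau ^ (k : ℕ) * Gk D v k j (coreEnd v S k) (coreCompl v S k ζ) = 0 := by
  by_cases hinv : S.card = 1 ∨ ∃ i ∈ S, ∃ i' ∈ S, i ≠ i' ∧ XiLinked ζ (oppFace v i) (oppFace v i')
  · -- invariant triple: the three weights coincide, and `1 + τ + τ² = 0`
    have hcls := h2 v hv S ζ hq hinv
    have hG : ∀ k : Fin 3, Gk D v k j (coreEnd v S k) (coreCompl v S k ζ) = Gk D v 0 j (coreEnd v S 0) (coreCompl v S 0 ζ) := by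
      intro k
      unfold Gk
      have e : (fun r m => InClass D (faceVertex v (k + 1)) (faceVertex v (k + 2)) (coreEnd v S k) r m (coreCompl v S k ζ)) =
          fun r m => InClass D (faceVertex v (0 + 1)) (faceVertex v (0 + 2)) (coreEnd v S 0) r m (coreCompl v S 0 ζ) := by
        funext r m; exact propext (hcls k 0 r m)
      rw [e]
    rw [Fin.sum_univ_three, hG 0, hG 1, hG 2]
    simp only [Fin.val_zero, Fin.val_one, Fin.val_two, pow_zero, pow_one, one_mul]
    linear_combination (Gk D v 0 j (coreEnd v S 0) (coreCompl v S 0 ζ)) * ha_tau_sum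
  · -- re-linking triple
    have hcard : ¬ S.card = 1 := fun h => hinv (Or.inl h)
    have hnolink : ∀ i ∈ S, ∀ i' ∈ S, i ≠ i' → ¬ XiLinked ζ (oppFace v i) (oppFace v i') :=
      fun i hi i' hi' hne hl => hinv (Or.inr ⟨i, hi, i', hi', hne, hl⟩)
    have hS : S = Finset.univ := by
      have hle : S.card ≤ 3 := by simpa using Finset.card_le_univ S
      obtain ⟨m, hm⟩ := hq.2.1
      apply Finset.eq_univ_of_card
      simp only [Fintype.card_fin]
      omega
    subst hS
    have hnl : ∀ i i' : Fin 3, i ≠ i' → ¬ XiLinked ζ (oppFace v i) (oppFace v i') :=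
      fun i i' hii' => hnolink i (Finset.mem_univ _) i' (Finset.mem_univ _) hii'
    choose p hp using ha_core_partners D hv hq hnl
    obtain ⟨c, rot, -, hc0, hc1, hc2, hcls⟩ := h3 v hv ζ hq p hp
    have hG : ∀ k : Fin 3, Gk D v k j (coreEnd v Finset.univ k) (coreCompl v Finset.univ k ζ) = phiW j (p k) (decide (p k = c + 3)) :=
      fun k => ha_Gk_eq_phiW D h1 hv k j hq (hcls k)
    have := h4 c j rot p hc0 hc1 hc2
    simp only [hG]
    exact this

/-! #### HA5. The assembly -/

/-- **(H) at every interior face, from the four typed faces HT1–HT4.** [cite: KhristoforovSmirnov2021, Lemma 4 (discrete holomorphicity: the triple bijection at a vertex)] -/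
theorem holomorphyAt_of_faces (h1 : CoreDecomposition D) (h2 : InvariantTriples D) (h3 : ReLinkingTriples D) (h4 : TripleAlgebra)
    {v : HexVertex} (hv : hexFaceVertices v ⊆ D.verts) : HolomorphyAt D v := by
  classical
  intro c j
  have h2G : (2 : ℂ) ^ #D.verts ≠ 0 := pow_ne_zero _ two_ne_zero
  have key : (2 : ℂ) ^ #D.verts * ∑ k : Fin 3, tau ^ (k : ℕ) * sparseObs D j c v (oppFace v k) = 0 := by
    rw [Finset.mul_sum]
    have step : ∀ k : Fin 3, (2 : ℂ) ^ #D.verts * (tau ^ (k : ℕ) * sparseObs D j c v (oppFace v k)) =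
        ∑ q ∈ coreSet D v, tau ^ (k : ℕ) * Gk D v k j (coreEnd v q.1 k) (coreCompl v q.1 k q.2) := by
      intro k
      rw [mul_left_comm, ha_sparseObs_eq_sum D hv, ha_regroup D h1 hv k (fun s ξ => Gk D v k j s ξ), Finset.mul_sum]
    simp only [step]
    rw [Finset.sum_comm]
    refine Finset.sum_eq_zero fun q hq => ?_
    rw [ha_mem_coreSet] at hq
    exact ha_core_vanish D h1 h2 h3 h4 hv j hq
  rcases mul_eq_zero.1 key with h | h
  · exact absurd h h2G
  · exact h

/-- the assembly, as the `Prop` recorded in the faces file. [cite: KhristoforovSmirnov2021, Lemma 4 (discrete holomorphicity: the triple bijection at a vertex)] -/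
theorem holomorphyAssembly_holds : HolomorphyAssembly D :=
  fun h1 h2 h3 h4 _ hv => holomorphyAt_of_faces D h1 h2 h3 h4 hv

/-! #### HA6. Reindexing to D1-v2's `ccwNbr` form -/

/-- the counter-clockwise neighbours are the opposite faces, up to a cyclic shift of the index for up faces. [cite: KhristoforovSmirnov2021, Lemma 4 (discrete holomorphicity: the triple bijection at a vertex)] -/
theorem ha_ccwNbr_eq_oppFace (v : HexVertex) (k : Fin 3) :
    ccwNbr v k = oppFace v (if v.2 = 0 then k + 2 else k) := by
  obtain ⟨x, t⟩ := v
  have ht : t = 0 ∨ t = 1 := by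
    rcases Fin.exists_fin_two.1 ⟨t, rfl⟩ with h | h
    · exact Or.inl h
    · exact Or.inr h
  rcases ht with rfl | rfl <;> fin_cases k <;> simp [ccwNbr, oppFace]

/-- `τ³ = 1`, stated as `τ³ − 1 = 0` to avoid a name-shape collision with an unrelated tree lemma (`GL2F5OrderThree.tau_pow_three`). [folklore] -/
private theorem ha_tau_cube : tau ^ 3 - 1 = 0 := by linear_combination (tau - 1) * ha_tau_sum

/-- (H) in D1-v2's form at `v`: `Σ_k τ^k F_j(v, ccwNbr v k) = 0`. [cite: KhristoforovSmirnov2021, Lemma 4 (discrete holomorphicity: the triple bijection at a vertex)] -/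
theorem holomorphy_ccw_of_faces (h1 : CoreDecomposition D) (h2 : InvariantTriples D) (h3 : ReLinkingTriples D) (h4 : TripleAlgebra)
    {v : HexVertex} (hv : hexFaceVertices v ⊆ D.verts) (c : Bool) (j : Fin 5) :
    ∑ k : Fin 3, tau ^ (k : ℕ) * sparseObs D j c v (ccwNbr v k) = 0 := by
  have hopp := holomorphyAt_of_faces D h1 h2 h3 h4 hv c j
  rw [Fin.sum_univ_three] at hopp ⊢
  simp only [ha_ccwNbr_eq_oppFace]
  by_cases hup : v.2 = 0
  · simp only [hup, ↓reduceIte, Fin.val_zero, Fin.val_one, Fin.val_two, pow_zero, pow_one, one_mul] at hopp ⊢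
    have e0 : ((0 : Fin 3) + 2) = 2 := by decide
    have e1 : ((1 : Fin 3) + 2) = 0 := by decide
    have e2 : ((2 : Fin 3) + 2) = 1 := by decide
    rw [e0, e1, e2]
    linear_combination tau * hopp - (sparseObs D j c v (oppFace v 2)) * ha_tau_cube
  · simp only [hup, ↓reduceIte, Fin.val_zero, Fin.val_one, Fin.val_two, pow_zero, pow_one, one_mul] at hopp ⊢
    exact hopp

/-- **D1-v2's (H) for the domain `D`, from the faces**: for every colour, reference index and interior face. [cite: KhristoforovSmirnov2021, Lemma 4 (discrete holomorphicity: the triple bijection at a vertex)] -/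
theorem hexFivePointHolomorphy_of_faces (h1 : CoreDecomposition D) (h2 : InvariantTriples D) (h3 : ReLinkingTriples D)
    (h4 : TripleAlgebra) : ∀ (c : Bool) (j : Fin 5) (v : HexVertex), hexFaceVertices v ⊆ D.verts →
      ∑ k : Fin 3, tau ^ (k : ℕ) * sparseObs D j c v (ccwNbr v k) = 0 :=
  fun c j _ hv => holomorphy_ccw_of_faces D h1 h2 h3 h4 hv c j

end N5

end Literature.Probability.Percolation.FivePoint

namespace Literature.Probability.Percolation.FivePoint

open Finset Literature.Probability.Percolation Literature.Probability.LatticeModels Literature.Probability.Percolation.FivePoint TriMarkedDomain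

namespace N5

/-- the one τ-identity behind HT4: `φ_j(c+2, A) + τ φ_j(c+3, B) + τ² φ_j(c+4, A) = [j = c+2] (1 - τ³) = 0`. [cite: KhristoforovSmirnov2021, Lemma 4 (discrete holomorphicity: the triple bijection at a vertex)] -/
theorem ha_T_zero (c j : Fin 5) :
    phiW j (c + 2) false + tau * phiW j (c + 3) true + tau ^ 2 * phiW j (c + 4) false = 0 := by
  classical
  have e1 : (c + 3 = j + 1) ↔ (c + 2 = j) := by revert c j; decide
  have e2 : (c + 3 = j + 4) ↔ (c + 4 = j) := by revert c j; decide
  have n24 : ¬ (c + 2 = j ∧ c + 4 = j) := by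
    rintro ⟨h, h'⟩
    exact absurd (add_left_cancel (h.trans h'.symm)) (by decide)
  unfold phiW
  simp only [e1, e2, and_true, Bool.false_eq_true, and_false, if_false, sub_zero, Bool.true_eq_false]
  by_cases h2 : c + 2 = j <;> by_cases h4 : c + 4 = j
  · exact absurd ⟨h2, h4⟩ n24
  · simp only [h2, h4, ↓reduceIte]
    linear_combination (-1 : ℂ) * ha_tau_cube
  · simp only [h2, h4, ↓reduceIte]
    ring
  · simp only [h2, h4, ↓reduceIte]
    ring

/-- **HT4 `TripleAlgebra` holds.** [cite: KhristoforovSmirnov2021, Lemma 4 (discrete holomorphicity: the triple bijection at a vertex)] -/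
theorem tripleAlgebra_holds : TripleAlgebra := by
  intro c j rot p h0 h1 h2
  have hT := ha_T_zero c j
  have d23 : decide (c + 2 = c + 3) = false := by
    rw [decide_eq_false_iff_not]; intro h; have := add_left_cancel h; revert this; decide
  have d33 : decide (c + 3 = c + 3) = true := by rw [decide_eq_true_iff]
  have d43 : decide (c + 4 = c + 3) = false := by
    rw [decide_eq_false_iff_not]; intro h; have := add_left_cancel h; revert this; decide
  rw [Fin.sum_univ_three]
  simp only [Fin.val_zero, Fin.val_one, Fin.val_two, pow_zero, pow_one, one_mul]
  have hrot : ∀ r : Fin 3, r = 0 ∨ r = 1 ∨ r = 2 := by decide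
  rcases hrot rot with rfl | rfl | rfl
  · rw [show (0 : Fin 3) + 1 = 1 from rfl] at h1
    rw [show (0 : Fin 3) + 2 = 2 from rfl] at h2
    rw [h0, h1, h2, d23, d33, d43]
    linear_combination hT
  · rw [show (1 : Fin 3) + 1 = 2 from rfl] at h1
    rw [show (1 : Fin 3) + 2 = 0 from rfl] at h2
    rw [h0, h1, h2, d23, d33, d43]
    linear_combination tau * hT + (-(phiW j (c + 4) false)) * ha_tau_cube
  · rw [show (2 : Fin 3) + 1 = 0 from rfl] at h1
    rw [show (2 : Fin 3) + 2 = 1 from rfl] at h2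
    rw [h0, h1, h2, d23, d33, d43]
    linear_combination tau ^ 2 * hT + (-(phiW j (c + 3) true) - tau * phiW j (c + 4) false) * ha_tau_cube

end N5

end Literature.Probability.Percolation.FivePoint
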